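import Summits.RiemannHypothesis.RiemannHypothesis.Theorems.WeilGroundStateGroundStatesConvergeToXiRenormBlowup
import Summits.RiemannHypothesis.RiemannHypothesis.Theorems.WeilGroundStateGroundStatesConvergeToXiEnergyLimit
import Summits.RiemannHypothesis.RiemannHypothesis.Theorems.WeilGroundStateGroundStatesConvergeToXiGapQuasimode
import HarnessLib

/-!
# `WeilGroundState.GroundStatesConvergeToXi` — the overlap criterion and the `L²` form of the
limit formula (crux item stmt-RiemannHypothesis-1527, route route-RiemannHypothesis-WeilGroundState;
line `Sketch`, lead c5; `--supports`)

RH-free consequences of the overlap–energy inequality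
`|ε(a)| · ‖⟨u, φ_a⟩‖ ≤ K exp(−(π/4)e^{2(a−1)}) e^{3a/2}` (`…RenormBlowup`,
`exists_abs_weilGroundEnergy_mul_norm_overlap_le_exp`; `φ_a = Φ · cutoff a` the window's truncated
Riemann kernel, `Φ(t) = 2Ψ(2t)`, `Φ̂ = ξ`) and of the energy dichotomy `RH ⟺ ε(a) → 0`,
`¬RH ⟺ ε(a) → −∞` (`…EnergyLimit`), with NO convergence hypothesis on Mellin transforms:

* **Overlap criterion** (`riemannHypothesis_of_overlap_ge_unbounded`,
  `riemannHypothesis_of_frequently_norm_overlap_ge`): if for some `L > 0` there are ground states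
  `u` at arbitrarily large windows `a` whose overlap with the window kernel is non-degenerate,
  `‖⟨u, φ_a⟩‖ ≥ L`, then the Riemann Hypothesis holds.  One real number per window.
* **Overlap dichotomy** (`eventually_norm_overlap_le_of_not_riemannHypothesis`,
  `riemannHypothesis_or_overlap_tendsto_zero`): under `¬RH` EVERY ground state at EVERY large
  window is double-exponentially orthogonal to the kernel, `‖⟨u, φ_a⟩‖ ≤ K e^{3a/2−(π/4)e^{2(a−1)}}`,
  uniformly over the (possibly degenerate) bottom eigenspace.
* The same with the UNTRUNCATED kernel `Φ` (`norm_overlap_phi_sub_phiCut_le`: the two overlaps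
  differ by at most `K' e^{3a/2−(π/4)e^{2(a−1)}}`).
* **The `L²` form of CCM25 §7 implies RH** (`riemannHypothesis_of_tendsto_integral_norm_sq_sub_phi`):
  if along SOME windows `a_k → ∞` some renormalised ground states converge to Riemann's kernel in
  `L²(ℝ)`, `∫ ‖c_k u_k − Φ‖² → 0`, then RH — no strip convergence, no tightness, no parity, no
  simplicity of the bottom, no Connes–van Suijlekom and no Hurwitz are needed for this form.
No new definitions.
-/

noncomputable section

set_option linter.dupNamespace false

open scoped Topology Real ComplexConjugate
open Filter Set MeasureTheory Complex

namespace Summit.RiemannHypothesis.RiemannHypothesis.Theorems.GroundStatesConvergeToXi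

open Literature.NumberTheory.LFunctions

/-! ## The overlap criterion -/

/-- **Overlap criterion, window form (RH-free).**  If for some `L > 0` there are, beyond every
bound `A`, a window `a ≥ A` and a ground state `u` at `a` with `‖⟨u, φ_a⟩‖ = ‖∫ u conj φ_a‖ ≥ L`,
then the Riemann Hypothesis holds.  Proof: the overlap–energy inequality gives
`|ε(a)| L ≤ K exp(−(π/4)e^{2(a−1)}) e^{3a/2} ≤ L` for all large such `a`, so `ε(a) ≥ −1` at
arbitrarily large windows; `ε` is antitone on `(0,∞)`, hence bounded below, hence RH
(`riemannHypothesis_of_weilGroundEnergy_bddBelow`). [folklore] -/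
theorem riemannHypothesis_of_overlap_ge_unbounded {L : ℝ} (hL : 0 < L)
    (h : ∀ A : ℝ, ∃ a : ℝ, A ≤ a ∧ ∃ u : ℝ → ℂ, IsWeilGroundState a u ∧
      L ≤ ‖∫ t, u t * conj ((2 : ℂ) * LagariasMontague.Psic (2 * t) *
        ((Literature.Analysis.Calculus.cutoff a t : ℝ) : ℂ))‖) :
    RiemannHypothesis := by
  obtain ⟨K, hK0, hK⟩ := exists_abs_weilGroundEnergy_mul_norm_overlap_le_exp
  have hzero : Tendsto (fun a : ℝ => K / L * (Real.exp (-(π / 4 * Real.exp (2 * (a - 1)))) *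
      Real.exp (3 / 2 * a))) atTop (𝓝 0) := by
    simpa using tendsto_superexp_mul_exp_threeHalves_zero.const_mul (K / L)
  obtain ⟨A₀, hA₀⟩ := ((hzero.eventually (ge_mem_nhds one_pos)).and
    (eventually_ge_atTop (1 : ℝ))).exists_forall_of_atTop
  refine riemannHypothesis_of_weilGroundEnergy_bddBelow ⟨-1, fun b hb => ?_⟩
  obtain ⟨a, hAa, u, hu, hLu⟩ := h (max b A₀)
  have hba : b ≤ a := (le_max_left _ _).trans hAa
  obtain ⟨hsmall, ha1⟩ := hA₀ a ((le_max_right _ _).trans hAa)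
  have h1 := hK a ha1 u hu
  have h3 : |weilGroundEnergy a| * L ≤ K * (Real.exp (-(π / 4 * Real.exp (2 * (a - 1)))) *
      Real.exp (3 / 2 * a)) :=
    (mul_le_mul_of_nonneg_left hLu (abs_nonneg _)).trans h1
  have h4 : |weilGroundEnergy a| ≤ K / L * (Real.exp (-(π / 4 * Real.exp (2 * (a - 1)))) *
      Real.exp (3 / 2 * a)) := by
    rw [div_mul_eq_mul_div, le_div_iff₀ hL]
    exact h3
  have h5 := (abs_le.1 (h4.trans hsmall)).1
  exact (show (-1 : ℝ) ≤ weilGroundEnergy a by linarith).trans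
    (Summit.RiemannHypothesis.Cruxes.GronwallLeakage.Negative.weilGroundEnergy_antitone_of_pos hb hba)

/-- **Overlap criterion, sequence form (RH-free).**  Ground states `u_k` at windows `a_k → ∞`
whose overlaps with the window kernels satisfy `‖⟨u_k, φ_{a_k}⟩‖ ≥ L > 0` for infinitely many `k`
prove the Riemann Hypothesis.  (No renormalisation, no convergence of transforms, no `L¹`
bound: compare `riemannHypothesis_of_overlap_nondegenerate`, `…_of_cruxWitness_norm_le`.) [folklore] -/
theorem riemannHypothesis_of_frequently_norm_overlap_ge {a : ℕ → ℝ} {u : ℕ → ℝ → ℂ}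
    (ha : Tendsto a atTop atTop) (hu : ∀ k, IsWeilGroundState (a k) (u k))
    (hL : ∃ L : ℝ, 0 < L ∧ ∃ᶠ k in atTop, L ≤ ‖∫ t, u k t * conj ((2 : ℂ) *
      LagariasMontague.Psic (2 * t) * ((Literature.Analysis.Calculus.cutoff (a k) t : ℝ) : ℂ))‖) :
    RiemannHypothesis := by
  obtain ⟨L, hL0, hLf⟩ := hL
  refine riemannHypothesis_of_overlap_ge_unbounded hL0 fun A => ?_
  obtain ⟨k, hk, hAk⟩ := (hLf.and_eventually (ha.eventually (eventually_ge_atTop A))).exists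
  exact ⟨a k, hAk, u k, hu k, hk⟩

/-! ## The overlap dichotomy -/

/-- **Under `¬RH` every ground state at every large window is double-exponentially orthogonal to
the window kernel**: there is `K ≥ 0` with `‖⟨u, φ_a⟩‖ ≤ K exp(−(π/4)e^{2(a−1)}) e^{3a/2}` for all
large `a` and ALL ground states `u` at `a` (uniformly over the bottom eigenspace).  Indeed
`ε(a) → −∞`, so `|ε(a)| ≥ 1` eventually, and the overlap–energy inequality divides out. [folklore] -/
theorem eventually_norm_overlap_le_of_not_riemannHypothesis (hRH : ¬ RiemannHypothesis) :
    ∃ K : ℝ, 0 ≤ K ∧ ∀ᶠ a : ℝ in atTop, ∀ u : ℝ → ℂ, IsWeilGroundState a u →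
      ‖∫ t, u t * conj ((2 : ℂ) * LagariasMontague.Psic (2 * t) *
          ((Literature.Analysis.Calculus.cutoff a t : ℝ) : ℂ))‖ ≤
        K * (Real.exp (-(π / 4 * Real.exp (2 * (a - 1)))) * Real.exp (3 / 2 * a)) := by
  obtain ⟨K, hK0, hK⟩ := exists_abs_weilGroundEnergy_mul_norm_overlap_le_exp
  have hbot := not_riemannHypothesis_iff_tendsto_weilGroundEnergy_atBot.1 hRH
  refine ⟨K, hK0, ?_⟩
  filter_upwards [tendsto_atBot.1 hbot (-1), eventually_ge_atTop (1 : ℝ)] with a hεa ha1 u hu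
  have h1 := hK a ha1 u hu
  have habs : 1 ≤ |weilGroundEnergy a| := by
    rw [abs_of_nonpos (by linarith)]
    linarith
  have h2 : ‖∫ t, u t * conj ((2 : ℂ) * LagariasMontague.Psic (2 * t) *
      ((Literature.Analysis.Calculus.cutoff a t : ℝ) : ℂ))‖ ≤
      |weilGroundEnergy a| * ‖∫ t, u t * conj ((2 : ℂ) * LagariasMontague.Psic (2 * t) *
        ((Literature.Analysis.Calculus.cutoff a t : ℝ) : ℂ))‖ :=
    le_mul_of_one_le_left (norm_nonneg _) habs
  exact h2.trans h1

/-- **Under `¬RH` the overlaps tend to `0` uniformly over ground states**: for every `δ > 0`,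
`‖⟨u, φ_a⟩‖ ≤ δ` for all large `a` and all ground states `u` at `a`. [folklore] -/
theorem eventually_norm_overlap_le_of_not_riemannHypothesis' (hRH : ¬ RiemannHypothesis)
    {δ : ℝ} (hδ : 0 < δ) :
    ∀ᶠ a : ℝ in atTop, ∀ u : ℝ → ℂ, IsWeilGroundState a u →
      ‖∫ t, u t * conj ((2 : ℂ) * LagariasMontague.Psic (2 * t) *
          ((Literature.Analysis.Calculus.cutoff a t : ℝ) : ℂ))‖ ≤ δ := by
  obtain ⟨K, -, hK⟩ := eventually_norm_overlap_le_of_not_riemannHypothesis hRH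
  have hzero : Tendsto (fun a : ℝ => K * (Real.exp (-(π / 4 * Real.exp (2 * (a - 1)))) *
      Real.exp (3 / 2 * a))) atTop (𝓝 0) := by
    simpa using tendsto_superexp_mul_exp_threeHalves_zero.const_mul K
  filter_upwards [hK, hzero.eventually (ge_mem_nhds hδ)] with a h1 h2 u hu
  exact (h1 u hu).trans h2

/-- **Overlap dichotomy (RH-free).**  Either the Riemann Hypothesis holds, or the overlaps
`⟨u, φ_a⟩` of ALL ground states with the window kernels tend to `0` as the window grows,
uniformly over ground states.  (Contrast: under RH + CCM25 §7 one expects `⟨u_a, φ_a⟩ → ‖Φ‖₂`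
up to phase; the crux numerics give `cos∠(u_a, Φχ_a) = 0.9997` at `a = 1.24`.) [folklore] -/
theorem riemannHypothesis_or_overlap_tendsto_zero :
    RiemannHypothesis ∨ ∀ δ : ℝ, 0 < δ → ∀ᶠ a : ℝ in atTop, ∀ u : ℝ → ℂ, IsWeilGroundState a u →
      ‖∫ t, u t * conj ((2 : ℂ) * LagariasMontague.Psic (2 * t) *
          ((Literature.Analysis.Calculus.cutoff a t : ℝ) : ℂ))‖ ≤ δ := by
  by_cases h : RiemannHypothesis
  · exact Or.inl h
  · exact Or.inr fun δ hδ => eventually_norm_overlap_le_of_not_riemannHypothesis' h hδ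

/-! ## The untruncated kernel `Φ` -/

/-- `Φ` is real: `conj Φ(t) = Φ(t)`. [folklore] -/
theorem conj_phi (t : ℝ) :
    conj ((2 : ℂ) * LagariasMontague.Psic (2 * t)) = (2 : ℂ) * LagariasMontague.Psic (2 * t) := by
  simp only [map_mul, map_ofNat, LagariasMontague.Psic, Complex.conj_ofReal]

/-- **Truncation costs nothing**: for a ground state `u` at a window `a ≥ 1`, the overlaps with
Riemann's kernel `Φ` and with the window's truncated kernel `φ_a = Φ · cutoff a` differ by at most
`K exp(−(π/4)e^{2(a−1)}) e^{3a/2}` (`Φ(1 − cutoff a)` lives on `|t| ≥ a − 1`, where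
`‖Φ(t)‖ ≤ K e^{|t|/2} exp(−(π/4)e^{2(a−1)})`, and `∫‖u‖e^{|t|/2} ≤ e^{3a/2}`). [folklore] -/
theorem norm_overlap_phi_sub_phiCut_le :
    ∃ K : ℝ, 0 ≤ K ∧ ∀ a : ℝ, 1 ≤ a → ∀ u : ℝ → ℂ, IsWeilGroundState a u →
      ‖(∫ t, u t * conj ((2 : ℂ) * LagariasMontague.Psic (2 * t))) -
          ∫ t, u t * conj ((2 : ℂ) * LagariasMontague.Psic (2 * t) *
            ((Literature.Analysis.Calculus.cutoff a t : ℝ) : ℂ))‖ ≤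
        K * (Real.exp (-(π / 4 * Real.exp (2 * (a - 1)))) * Real.exp (3 / 2 * a)) := by
  obtain ⟨K, hK0, hΦ⟩ := exists_norm_phi_le
  refine ⟨K, hK0, fun a ha u hu => ?_⟩
  set η : ℝ := Real.exp (-(π / 4 * Real.exp (2 * (a - 1)))) with hηdef
  have hη0 : 0 ≤ η := (Real.exp_pos _).le
  have hcχ : Continuous fun t : ℝ => ((Literature.Analysis.Calculus.cutoff a t : ℝ) : ℂ) :=
    continuous_ofReal.comp (Literature.Analysis.Calculus.contDiff_cutoff a (n := 0)).continuous
  have hi1 : Integrable fun t => u t * conj ((2 : ℂ) * LagariasMontague.Psic (2 * t)) :=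
    hu.integrable_mul_continuous (Complex.continuous_conj.comp continuous_phi)
  have hi2 : Integrable fun t => u t * conj ((2 : ℂ) * LagariasMontague.Psic (2 * t) *
      ((Literature.Analysis.Calculus.cutoff a t : ℝ) : ℂ)) :=
    hu.integrable_mul_continuous (Complex.continuous_conj.comp (continuous_phi.mul hcχ))
  have hdom : Integrable fun t : ℝ => K * η * (‖u t‖ * Real.exp (1 / 2 * |t|)) := by
    have h1 : Integrable fun t : ℝ => u t * ((Real.exp (1 / 2 * |t|) : ℝ) : ℂ) :=
      hu.integrable_mul_continuous (by fun_prop)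
    refine (h1.norm.const_mul (K * η)).congr (ae_of_all _ fun t => ?_)
    simp only [norm_mul, Complex.norm_real, Real.norm_eq_abs, abs_of_pos (Real.exp_pos _)]
  -- pointwise bound `‖u Φ̄ (1 - χ)‖ ≤ K η ‖u‖ e^{|t|/2}`
  have hpt : ∀ t : ℝ, ‖u t * conj ((2 : ℂ) * LagariasMontague.Psic (2 * t)) -
      u t * conj ((2 : ℂ) * LagariasMontague.Psic (2 * t) *
        ((Literature.Analysis.Calculus.cutoff a t : ℝ) : ℂ))‖ ≤
      K * η * (‖u t‖ * Real.exp (1 / 2 * |t|)) := by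
    intro t
    have e : u t * conj ((2 : ℂ) * LagariasMontague.Psic (2 * t)) -
        u t * conj ((2 : ℂ) * LagariasMontague.Psic (2 * t) *
          ((Literature.Analysis.Calculus.cutoff a t : ℝ) : ℂ)) =
        u t * conj ((2 : ℂ) * LagariasMontague.Psic (2 * t)) *
          (((1 - Literature.Analysis.Calculus.cutoff a t : ℝ) : ℂ)) := by
      simp only [map_mul, map_ofNat, LagariasMontague.Psic, Complex.conj_ofReal]
      push_cast
      ring
    rw [e, norm_mul, norm_mul, Complex.norm_conj, Complex.norm_real, Real.norm_eq_abs,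
      abs_of_nonneg (sub_nonneg.2 (Literature.Analysis.Calculus.cutoff_le_one a t))]
    by_cases ht : |t| ≤ a - 1
    · rw [Literature.Analysis.Calculus.cutoff_eq_one ht, sub_self, mul_zero]
      positivity
    · have h1 : 1 - Literature.Analysis.Calculus.cutoff a t ≤ 1 := by
        linarith [Literature.Analysis.Calculus.cutoff_nonneg a t]
      have h2 : ‖(2 : ℂ) * LagariasMontague.Psic (2 * t)‖ ≤ K * η * Real.exp (1 / 2 * |t|) := by
        refine (hΦ t).trans ?_
        rw [mul_assoc, ← Real.exp_add]
        refine mul_le_mul_of_nonneg_left (Real.exp_le_exp.2 ?_) hK0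
        have h3 : Real.exp (2 * (a - 1)) ≤ Real.exp (2 * |t|) :=
          Real.exp_le_exp.2 (by linarith [lt_of_not_ge ht])
        nlinarith [Real.pi_pos]
      calc ‖u t‖ * ‖(2 : ℂ) * LagariasMontague.Psic (2 * t)‖ * (1 - Literature.Analysis.Calculus.cutoff a t)
          ≤ ‖u t‖ * ‖(2 : ℂ) * LagariasMontague.Psic (2 * t)‖ * 1 := by gcongr
        _ ≤ ‖u t‖ * (K * η * Real.exp (1 / 2 * |t|)) * 1 := by gcongr
        _ = K * η * (‖u t‖ * Real.exp (1 / 2 * |t|)) := by ring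
  rw [← integral_sub hi1 hi2]
  calc ‖∫ t, (u t * conj ((2 : ℂ) * LagariasMontague.Psic (2 * t)) -
        u t * conj ((2 : ℂ) * LagariasMontague.Psic (2 * t) *
          ((Literature.Analysis.Calculus.cutoff a t : ℝ) : ℂ)))‖
      ≤ ∫ t, ‖u t * conj ((2 : ℂ) * LagariasMontague.Psic (2 * t)) -
        u t * conj ((2 : ℂ) * LagariasMontague.Psic (2 * t) *
          ((Literature.Analysis.Calculus.cutoff a t : ℝ) : ℂ))‖ := norm_integral_le_integral_norm _
    _ ≤ ∫ t, K * η * (‖u t‖ * Real.exp (1 / 2 * |t|)) :=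
        integral_mono (hi1.sub hi2).norm hdom hpt
    _ = K * η * ∫ t, ‖u t‖ * Real.exp (1 / 2 * |t|) := integral_const_mul _ _
    _ ≤ K * η * Real.exp (3 / 2 * a) :=
        mul_le_mul_of_nonneg_left (integral_norm_mul_exp_half_le_exp hu) (by positivity)
    _ = K * (η * Real.exp (3 / 2 * a)) := by ring

/-- **Overlap criterion with the untruncated kernel (RH-free)**: ground states `u_k` at windows
`a_k → ∞` with `‖⟨u_k, Φ⟩‖ = ‖∫ u_k conj Φ‖ ≥ L > 0` for infinitely many `k` prove RH. [folklore] -/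
theorem riemannHypothesis_of_frequently_norm_overlap_phi_ge {a : ℕ → ℝ} {u : ℕ → ℝ → ℂ}
    (ha : Tendsto a atTop atTop) (hu : ∀ k, IsWeilGroundState (a k) (u k))
    (hL : ∃ L : ℝ, 0 < L ∧ ∃ᶠ k in atTop,
      L ≤ ‖∫ t, u k t * conj ((2 : ℂ) * LagariasMontague.Psic (2 * t))‖) :
    RiemannHypothesis := by
  obtain ⟨L, hL0, hLf⟩ := hL
  obtain ⟨K, -, hK⟩ := norm_overlap_phi_sub_phiCut_le
  have hzero : Tendsto (fun k => K * (Real.exp (-(π / 4 * Real.exp (2 * (a k - 1)))) *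
      Real.exp (3 / 2 * a k))) atTop (𝓝 0) := by
    simpa using (tendsto_superexp_mul_exp_threeHalves_zero.comp ha).const_mul K
  refine riemannHypothesis_of_frequently_norm_overlap_ge ha hu ⟨L / 2, by positivity, ?_⟩
  refine (hLf.and_eventually ((ha.eventually (eventually_ge_atTop (1 : ℝ))).and
    (hzero.eventually (ge_mem_nhds (half_pos hL0))))).mono fun k hk => ?_
  obtain ⟨hk, hak, hsmall⟩ := hk
  have h1 := hK (a k) hak (u k) (hu k)
  have h2 := norm_sub_norm_le (∫ t, u k t * conj ((2 : ℂ) * LagariasMontague.Psic (2 * t)))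
    (∫ t, u k t * conj ((2 : ℂ) * LagariasMontague.Psic (2 * t) *
      ((Literature.Analysis.Calculus.cutoff (a k) t : ℝ) : ℂ)))
  linarith

/-- **Under `¬RH`, every ground state at every large window is nearly orthogonal to Riemann's
kernel itself**: `‖⟨u, Φ⟩‖ ≤ (K + K') exp(−(π/4)e^{2(a−1)}) e^{3a/2}`. [folklore] -/
theorem eventually_norm_overlap_phi_le_of_not_riemannHypothesis (hRH : ¬ RiemannHypothesis) :
    ∃ K : ℝ, 0 ≤ K ∧ ∀ᶠ a : ℝ in atTop, ∀ u : ℝ → ℂ, IsWeilGroundState a u →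
      ‖∫ t, u t * conj ((2 : ℂ) * LagariasMontague.Psic (2 * t))‖ ≤
        K * (Real.exp (-(π / 4 * Real.exp (2 * (a - 1)))) * Real.exp (3 / 2 * a)) := by
  obtain ⟨K, hK0, hK⟩ := eventually_norm_overlap_le_of_not_riemannHypothesis hRH
  obtain ⟨K', hK'0, hK'⟩ := norm_overlap_phi_sub_phiCut_le
  refine ⟨K + K', by positivity, ?_⟩
  filter_upwards [hK, eventually_ge_atTop (1 : ℝ)] with a h1 ha1 u hu
  have h2 := h1 u hu
  have h3 := hK' a ha1 u hu
  have h4 := norm_sub_norm_le (∫ t, u t * conj ((2 : ℂ) * LagariasMontague.Psic (2 * t)))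
    (∫ t, u t * conj ((2 : ℂ) * LagariasMontague.Psic (2 * t) *
      ((Literature.Analysis.Calculus.cutoff a t : ℝ) : ℂ)))
  nlinarith

/-! ## The `L²` form of the limit formula implies RH -/

/-- **`L²`-convergence of renormalised ground states to Riemann's kernel, along SOME sequence of
windows, implies the Riemann Hypothesis (RH-free mechanism).**  Let `a_k → ∞`, `u_k` ground
states at `a_k` and `c_k` scalars with `∫ ‖c_k u_k − Φ‖² → 0`.  Then: `c_k⟨u_k, Φ⟩ → ‖Φ‖₂² > 0`
(Cauchy–Schwarz), `‖c_k‖ = ‖c_k u_k‖₂ ≤ ‖c_k u_k − Φ‖₂ + ‖Φ‖₂` stays bounded (Minkowski), so the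
overlaps `‖⟨u_k, Φ⟩‖` stay bounded away from `0`, and
`riemannHypothesis_of_frequently_norm_overlap_phi_ge` concludes.  This is the position-space `L²`
form of CCM25 §7 (Connes–Consani–Moscovici, arXiv:2511.22755 §7) — it implies RH with no
convergence on the strip, no parity or simplicity of the bottom, no Connes–van Suijlekom theorem
and no Hurwitz argument. [folklore] -/
theorem riemannHypothesis_of_tendsto_integral_norm_sq_sub_phi {a : ℕ → ℝ} {u : ℕ → ℝ → ℂ}
    {c : ℕ → ℂ} (ha : Tendsto a atTop atTop) (hu : ∀ k, IsWeilGroundState (a k) (u k))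
    (hL2 : Tendsto (fun k => ∫ t, ‖c k * u k t - 2 * LagariasMontague.Psic (2 * t)‖ ^ 2)
      atTop (𝓝 0)) :
    RiemannHypothesis := by
  obtain ⟨hPP, hP⟩ := integral_phi_mul_phi_eq_and_pos
  set Φ : ℝ → ℂ := fun t => (2 : ℂ) * LagariasMontague.Psic (2 * t) with hΦdef
  set P : ℝ := ∫ t : ℝ, ‖Φ t‖ ^ 2 with hPdef
  have hΦ2 : MemLp Φ 2 := Negative.memLp_phi
  have hsP : 0 < Real.sqrt P := Real.sqrt_pos.2 hP
  have hsP2 : Real.sqrt P * Real.sqrt P = P := Real.mul_self_sqrt hP.le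
  obtain ⟨M₀, -, hM₀⟩ := Negative.exists_norm_phi_le
  -- the positive lower bound for the overlaps with `Φ`
  set L : ℝ := 3 * P / 4 / (5 * Real.sqrt P / 4 + 1) with hLdef
  have hL0 : 0 < L := by positivity
  refine riemannHypothesis_of_frequently_norm_overlap_phi_ge ha hu ⟨L, hL0, ?_⟩
  have hev : ∀ᶠ k in atTop, ∫ t, ‖c k * u k t - Φ t‖ ^ 2 ≤ P / 16 :=
    hL2.eventually (ge_mem_nhds (by positivity))
  refine Eventually.frequently (hev.mono fun k hk => ?_)
  have huk := hu k
  have hcu2 : MemLp (fun t => c k * u k t) 2 := huk.memLp.const_mul (c k)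
  have hw2 : MemLp (fun t => c k * u k t - Φ t) 2 := hcu2.sub hΦ2
  -- (1) `√(∫‖w‖²) ≤ √P / 4`
  have hsw : Real.sqrt (∫ t, ‖c k * u k t - Φ t‖ ^ 2) ≤ Real.sqrt P / 4 := by
    rw [show Real.sqrt P / 4 = Real.sqrt (P / 16) by
      rw [show P / 16 = P / (4 ^ 2) by norm_num, Real.sqrt_div' _ (by norm_num : (0:ℝ) ≤ 4 ^ 2),
        Real.sqrt_sq (by norm_num : (0:ℝ) ≤ 4)]]
    exact Real.sqrt_le_sqrt hk
  -- (2) `‖c_k ∫ u_k conj Φ − P‖ ≤ P / 4`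
  have hi_cuΦ : Integrable fun t => c k * u k t * Φ t :=
    (huk.integrable_mul_continuous continuous_phi).const_mul (c k) |>.congr
      (ae_of_all _ fun t => by ring)
  have hi_ΦΦ : Integrable fun t => Φ t * Φ t :=
    Negative.integrable_phi.bdd_mul continuous_phi.aestronglyMeasurable (ae_of_all _ hM₀)
  have hdiff : c k * (∫ t, u k t * conj (Φ t)) - (P : ℂ) = ∫ t, (c k * u k t - Φ t) * Φ t := by
    have e1 : c k * (∫ t, u k t * conj (Φ t)) = ∫ t, c k * u k t * Φ t := by
      rw [← integral_const_mul]
      refine integral_congr_ae (ae_of_all _ fun t => ?_)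
      simp only [hΦdef, conj_phi]; ring
    rw [e1, hPdef, ← hPP, ← integral_sub hi_cuΦ hi_ΦΦ]
    refine integral_congr_ae (ae_of_all _ fun t => ?_)
    ring
  have hCS : ‖c k * (∫ t, u k t * conj (Φ t)) - (P : ℂ)‖ ≤ P / 4 := by
    rw [hdiff]
    refine (norm_integral_mul_le_sqrt_mul_sqrt hw2 hΦ2).trans ?_
    calc Real.sqrt (∫ t, ‖c k * u k t - Φ t‖ ^ 2) * Real.sqrt (∫ t, ‖Φ t‖ ^ 2)
        ≤ Real.sqrt P / 4 * Real.sqrt P := mul_le_mul_of_nonneg_right hsw (Real.sqrt_nonneg _)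
      _ = P / 4 := by rw [div_mul_eq_mul_div, hsP2]
  have hov : 3 * P / 4 ≤ ‖c k‖ * ‖∫ t, u k t * conj (Φ t)‖ := by
    rw [← norm_mul]
    have h1 := norm_sub_norm_le ((P : ℂ)) (c k * ∫ t, u k t * conj (Φ t))
    rw [norm_sub_rev, Complex.norm_real, Real.norm_eq_abs, abs_of_pos hP] at h1
    linarith
  -- (3) `‖c_k‖ ≤ 5√P/4`
  have hcn : ‖c k‖ ≤ 5 * Real.sqrt P / 4 := by
    have h1 := sqrt_integral_norm_sq_sub_le (f := fun t => c k * u k t - Φ t)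
      (h := fun t => -Φ t) hw2 hΦ2.neg
    have e2 : ∫ t, ‖c k * u k t‖ ^ 2 = ‖c k‖ ^ 2 := by
      simp only [norm_mul, mul_pow]
      rw [integral_const_mul, huk.integral_norm_sq, mul_one]
    simp only [sub_neg_eq_add, sub_add_cancel, norm_neg] at h1
    rw [e2, Real.sqrt_sq (norm_nonneg _)] at h1
    linarith
  -- (4) divide
  have hcpos : 0 < ‖c k‖ := by
    rcases (norm_nonneg (c k)).eq_or_lt with h | h
    · rw [← h, zero_mul] at hov; linarith
    · exact h
  rw [hLdef, div_le_iff₀ (by positivity)]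
  calc 3 * P / 4 ≤ ‖c k‖ * ‖∫ t, u k t * conj (Φ t)‖ := hov
    _ ≤ (5 * Real.sqrt P / 4 + 1) * ‖∫ t, u k t * conj (Φ t)‖ :=
        mul_le_mul_of_nonneg_right (by linarith) (norm_nonneg _)
    _ = ‖∫ t, u k t * conj (Φ t)‖ * (5 * Real.sqrt P / 4 + 1) := mul_comm _ _

end Summit.RiemannHypothesis.RiemannHypothesis.Theorems.GroundStatesConvergeToXi

end
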